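import Summits.AtomisticToContinuum.Crystallization.Theorems.HullExactificationCascadeRobustBarlowTemplateInjectiveAssembly
import Summits.AtomisticToContinuum.Crystallization.Theorems.HullExactificationCascadeRobustBarlowTemplateInjectiveStarApprox

/-!
# Stub `develop_injective` for line `registered` (crux `RobustBarlowTemplate`, stmt-AtomisticToContinuum-12088)

The registered skeleton stub `develop_injective` (skeleton stub 2d): a shell covering `Ψ` of a
`δ`-separated configuration by the ideal stacking of a Hägg sequence, with the local-similarity
property, is injective on the ideal stacking.  It is the composition of the star estimate
`injective_starApprox` (…InjectiveStarApprox) with the assembly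
`develop_injective_of_starApprox` (…InjectiveAssembly: the piecewise-affine extension of
`Ψ ∘ siteAt s` is a continuous open self-map of `ℝ³`, injective on `1/6`-balls with images
containing uniform balls, hence bijective by the covering criterion).
-/

noncomputable section

namespace Summit.AtomisticToContinuum.Crystallization.Theorems.HullExactificationCascadeRobustBarlowTemplate

open Literature.MathematicalPhysics.StatisticalMechanics

/-- Euclidean `3`-space. -/
local notation "E3" => EuclideanSpace ℝ (Fin 3)

/-- **Stub `develop_injective`** (skeleton stub 2d): a shell covering `Ψ` of a `δ`-separated
configuration `S` by the ideal stacking of a Hägg sequence `s`, with the local-similarity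
property, is injective on the ideal stacking — the star estimate `injective_starApprox` fed into
the assembly `develop_injective_of_starApprox`. -/
theorem develop_injective : ∀ δ : ℝ, 0 < δ → ∀ S : Set E3, Sep δ S → (∀ y ∈ S, Good S y) → Recip S → ∀ (s : ℤ → ℤ) (Ψ : E3 → E3), IsHaggSeq s → IsShellCovering S s Ψ → LocSim s Ψ → Set.InjOn Ψ (idealStacking s) :=
  develop_injective_of_starApprox injective_starApprox

end Summit.AtomisticToContinuum.Crystallization.Theorems.HullExactificationCascadeRobustBarlowTemplate

end
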